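import Mathlib
import Summits.ValiantsHypothesis.ValiantsHypothesis.Theorems.NewtonTauWeak.Negative.Zonogon

/-!
# `NewtonTauWeak` (stmt-ValiantsHypothesis-5904), line `binomial-normal-form`: objects of the GENERAL CARRY AUTOMATON
# (digit-scaled level polynomials of bounded degree; lead c4, THEOREM B)

Route-posited objects (D-0016 `…Defs` file) generalising `…AutomatonDefs.lean` (digit hexagon, THEOREM A
`hex_digitHexagon_quasiPoly`, p125931) from the three binomials of a level to an ARBITRARY level polynomial of degree `≤ C` in
each variable: a product `Π_{i<n} G_i(x^{2^i}, y^{2^i})` (`genProd`, via `MvPolynomial.expand (2^i)`) — in the crux's language, a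
product of `t`-sparse factors `f_j = g_j(x^{2^{lev j}}, y^{2^{lev j}})` grouped by level — has coefficient at `(p, q)` equal to an
entry of the ordered product of the CARRY TRANSFER MATRICES `genT C G_i p_i q_i` on the states `κ ∈ {0..C}²` (carries bounded by
`C`): entry `κ → κ'` = the coefficient of `G_i` at `(2κ'₁ + p_i - κ₁, 2κ'₂ + q_i - κ₂)` (the level contribution `u` is forced by
`u + κ = digit + 2κ'`).  The position is `digits + 2^n · (final state)`.  As for Theorem A, the coefficient array of a sum of `k`
such products is a linear image of the vector configuration `genVecFin` (dimension `k (C+1)⁴`), bilinearly self-similar under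
digit splitting (`genContract`), so Theorem Q's greedy-shadow product step yields a quasi-polynomial bound UNIFORM IN `k`
(`…AutomatonGenAssembly.lean`).  Everything here is a definition [folklore: carry automaton / transfer matrices].
-/

-- the namespace mandated for this Theorems file repeats the component `ValiantsHypothesis`
set_option linter.dupNamespace false

noncomputable section

open scoped BigOperators
open MvPolynomial

namespace Summit.ValiantsHypothesis.ValiantsHypothesis.Theorems.NewtonTauWeakAutomaton

/-! ## States and transfer matrices -/

/-- Carry states bounded by `C`: pairs `(κ₁, κ₂) ∈ {0, …, C}²`. [folklore] -/
abbrev GSt (C : ℕ) : Type := Fin (C + 1) × Fin (C + 1)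

/-- The carry transfer matrix of a level polynomial `G` (degree `≤ C` in each variable) reading the digit pair `(p, q)`:
entry `κ → κ'` is the coefficient of `G` at the forced level contribution `(2κ'₁ + p - κ₁, 2κ'₂ + q - κ₂)` (zero if negative).
[folklore] -/
def genT (C : ℕ) (G : MvPolynomial (Fin 2) ℂ) (p q : ℕ) : Matrix (GSt C) (GSt C) ℂ := fun κ κ' =>
  if (κ.1 : ℕ) ≤ 2 * κ'.1 + p ∧ (κ.2 : ℕ) ≤ 2 * κ'.2 + q then
    coeff (Finsupp.single 0 (2 * (κ'.1 : ℕ) + p - κ.1) + Finsupp.single 1 (2 * (κ'.2 : ℕ) + q - κ.2)) G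
  else 0

/-- The ordered product of the transfer matrices of the levels `lo, …, lo+len-1` (level polynomials `G : ℕ → …`), reading the
binary digits of the position `P` at those levels. [folklore] -/
def genN (C : ℕ) (G : ℕ → MvPolynomial (Fin 2) ℂ) (lo len : ℕ) (P : ℕ × ℕ) : Matrix (GSt C) (GSt C) ℂ :=
  ((List.range' lo len).map fun i => genT C (G i) (P.1.testBit i).toNat (P.2.testBit i).toNat).prod

/-! ## The vector configuration of `k` products -/

/-- Index type of the configuration vectors: (product, in-state, out-state). [folklore] -/
abbrev GIdx (k C : ℕ) : Type := Fin k × (GSt C × GSt C)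

/-- `GIdx k C` has `k · ((C+1)(C+1))²` elements. -/
theorem card_GIdx (k C : ℕ) : Fintype.card (GIdx k C) = k * ((C + 1) * (C + 1) * ((C + 1) * (C + 1))) := by
  simp [GIdx, GSt, Fintype.card_prod, Fintype.card_fin]

/-- A fixed enumeration `GIdx k C ≃ Fin (k · ((C+1)(C+1))²)`. [folklore] -/
def gidxEquiv (k C : ℕ) : GIdx k C ≃ Fin (k * ((C + 1) * (C + 1) * ((C + 1) * (C + 1)))) :=
  Fintype.equivFinOfCardEq (card_GIdx k C)

/-- The configuration vector at position `P` of `k` products with level polynomials `G : Fin k → ℕ → …`, over the levels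
`[lo, lo+len)`: all entries of all `k` transfer-matrix products. [folklore] -/
def genVec (k C : ℕ) (G : Fin k → ℕ → MvPolynomial (Fin 2) ℂ) (lo len : ℕ) (P : ℕ × ℕ) : GIdx k C → ℂ :=
  fun i => genN C (G i.1) lo len P i.2.1 i.2.2

/-- The same vector, flattened (the shape used by Theorem Q's `QuasiPoly.cshadow`). [folklore] -/
def genVecFin (k C : ℕ) (G : Fin k → ℕ → MvPolynomial (Fin 2) ℂ) (lo len : ℕ) (P : ℕ × ℕ) :
    Fin (k * ((C + 1) * (C + 1) * ((C + 1) * (C + 1)))) → ℂ :=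
  fun j => genVec k C G lo len P ((gidxEquiv k C).symm j)

/-- Shifting the level polynomials by `h` levels. [folklore] -/
def shiftLev {k : ℕ} (G : Fin k → ℕ → MvPolynomial (Fin 2) ℂ) (h : ℕ) : Fin k → ℕ → MvPolynomial (Fin 2) ℂ :=
  fun l i => G l (i + h)

/-- The contraction realising blockwise matrix multiplication "low levels first, then high levels" on Kronecker products
(cf. `hexContract`). [folklore] -/
def genContract (k C : ℕ) :
    (Fin (k * ((C + 1) * (C + 1) * ((C + 1) * (C + 1))) * (k * ((C + 1) * (C + 1) * ((C + 1) * (C + 1))))) → ℂ) →ₗ[ℂ]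
      (Fin (k * ((C + 1) * (C + 1) * ((C + 1) * (C + 1)))) → ℂ) where
  toFun Z j :=
    let i := (gidxEquiv k C).symm j
    ∑ κ' : GSt C, Z (finProdFinEquiv (gidxEquiv k C (i.1, (κ', i.2.2)), gidxEquiv k C (i.1, (i.2.1, κ'))))
  map_add' Z Z' := by
    funext j
    simp only [Pi.add_apply]
    rw [← Finset.sum_add_distrib]
  map_smul' c Z := by
    funext j
    simp only [Pi.smul_apply, smul_eq_mul, RingHom.id_apply]
    rw [Finset.mul_sum]

/-! ## The polynomials -/

/-- A digit-scaled product with `n` levels: `Π_{i<n} G_i(x^{2^i}, y^{2^i})`. [folklore] -/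
def genProd (G : ℕ → MvPolynomial (Fin 2) ℂ) (n : ℕ) : MvPolynomial (Fin 2) ℂ :=
  ∏ i ∈ Finset.range n, MvPolynomial.expand (2 ^ i) (G i)

/-- A sum of `k` scalar multiples of digit-scaled products on a common `n`-level hierarchy. [folklore] -/
def genSum (k n : ℕ) (c : Fin k → ℂ) (G : Fin k → ℕ → MvPolynomial (Fin 2) ℂ) : MvPolynomial (Fin 2) ℂ :=
  ∑ l, C (c l) * genProd (G l) n

/-- The degree hypothesis: every level polynomial has degree `≤ C` in each variable. [folklore] -/
def DegLE (C : ℕ) {k : ℕ} (G : Fin k → ℕ → MvPolynomial (Fin 2) ℂ) : Prop :=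
  ∀ l i, ∀ e ∈ (G l i).support, e 0 ≤ C ∧ e 1 ≤ C

end Summit.ValiantsHypothesis.ValiantsHypothesis.Theorems.NewtonTauWeakAutomaton

end
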